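import Literature.Geometry.Symplectic.AkbulutMatveyev
import Literature.Topology.FourManifolds.NiceMorseFunctionsProofs
import HarnessLib

/-!
# Akbulut–Matveyev's convex decomposition theorem from the paper's Theorem 3 alone

Topic `Literature/Geometry/Symplectic`.  `AkbulutMatveyev.lean` proves the paper's assembly
"abstract ⇐ Theorem 3 + a handle decomposition" as `akbulut_matveyev_of_thm3 h3 hR`, where `h3`
is the paper's Theorem 3 as printed (the remaining proof obligation of the fact
`akbulut_matveyev`) and `hR : exists_isSelfIndexing_criticalSet_eq 4` is Milnor's final
rearrangement theorem for closed `4`-manifolds (every closed smooth manifold with a Morse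
function carries a self-indexing Morse function with the same critical data; Milnor 1965,
Thm. 4.8 / Def. 4.9), a named fact of `NiceMorseFunctions.lean`.  That fact is **discharged** in
the tree (`exists_isSelfIndexing_criticalSet_eq_holds`, `NiceMorseFunctionsProofs.lean`, from the
proved triad theorem `Cobordism.Milnor1965_finalRearrangement_holds`), so:

* `akbulut_matveyev_of_thm3'` — **`akbulut_matveyev` follows from the paper's Theorem 3 alone**:
  the only remaining input of the fact is the inline proof of Theorem 3 (hypothesis `h3`,
  verbatim the hypothesis of `akbulut_matveyev_of_thm3`).

(Kept in a separate file so that `AkbulutMatveyev.lean` does not import the h-cobordism files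
behind `NiceMorseFunctionsProofs.lean`.)

## References

* S. Akbulut, R. Matveyev, IMRN 1998, abstract, Thm. 3 and §4. [AkbulutMatveyev1998]
* J. Milnor, *Lectures on the h-cobordism theorem* (1965), Thm. 4.8, Def. 4.9.
  [MilnorHCobordism1965]
-/

noncomputable section

open scoped Manifold ContDiff

namespace Literature.Geometry.Symplectic

open Literature.Topology.FourManifolds

/-- **Akbulut–Matveyev's convex decomposition theorem follows from the paper's Theorem 3
alone**: the assembly `akbulut_matveyev_of_thm3` with its Morse-theoretic input R(4) fed the
tree's discharge `exists_isSelfIndexing_criticalSet_eq_holds 4` (Milnor 1965, Thm. 4.8).  The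
hypothesis `h3` is Theorem 3 as printed, in the audited rendering of `AkbulutMatveyev.lean`
(verbatim the hypothesis of `akbulut_matveyev_of_thm3`). [cite: AkbulutMatveyev1998, abstract and Thm. 3] -/
theorem akbulut_matveyev_of_thm3'
    (h3 : ∀ (X : Type) [TopologicalSpace X] [T2Space X] [SecondCountableTopology X]
      [CompactSpace X] [ChartedSpace (EuclideanSpace ℝ (Fin 4)) X] [IsManifold (𝓡 4) ∞ X],
      Literature.Topology.FourManifolds.IsOrientable (𝓡 4) X →
      ∀ (X₁ X₂ : Type) [TopologicalSpace X₁] [ChartedSpace (EuclideanHalfSpace 4) X₁]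
        [IsManifold (𝓡∂ 4) ∞ X₁] [CompactSpace X₁] [TopologicalSpace X₂]
        [ChartedSpace (EuclideanHalfSpace 4) X₂] [IsManifold (𝓡∂ 4) ∞ X₂] [CompactSpace X₂]
        (R : X₁ → X₂ → Prop),
        Literature.Topology.FourManifolds.IsHandlebodyOfIndexLE 3 2 X₁ →
        Literature.Topology.FourManifolds.IsHandlebodyOfIndexLE 3 2 X₂ →
        IsBoundaryRelation X₁ X₂ R →
        Literature.Topology.FourManifolds.IsClosedGluing (𝓡∂ 4) (𝓡∂ 4) (𝓡 4) (P := X) R →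
        ∃ (W₁ W₂ : Type) (_ : TopologicalSpace W₁) (_ : ChartedSpace (EuclideanHalfSpace 4) W₁)
          (_ : IsManifold (𝓡∂ 4) ∞ W₁) (_ : CompactSpace W₁)
          (_ : TopologicalSpace W₂) (_ : ChartedSpace (EuclideanHalfSpace 4) W₂)
          (_ : IsManifold (𝓡∂ 4) ∞ W₂) (_ : CompactSpace W₂) (R' : W₁ → W₂ → Prop),
          IsSteinDomain W₁ ∧ IsSteinDomain W₂ ∧ IsBoundaryRelation W₁ W₂ R' ∧
            Literature.Topology.FourManifolds.IsClosedGluing (𝓡∂ 4) (𝓡∂ 4) (𝓡 4) (P := X) R' ∧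
            Nonempty (ContinuousMap.HomotopyEquiv W₁ X₁) ∧
            Nonempty (ContinuousMap.HomotopyEquiv W₂ X₂)) :
    akbulut_matveyev :=
  akbulut_matveyev_of_thm3 h3 (exists_isSelfIndexing_criticalSet_eq_holds 4)

end Literature.Geometry.Symplectic

end
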